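import Summits.ABC.IUTFork.Joshi.ArithTeichmullerSpacePointed
import Summits.ABC.IUTFork.Joshi.ATS1SpacesStructure
import Literature.AnabelianGeometry.EtaleTheta.Thm16SubdagCompanion
import Literature.AnabelianGeometry.AbsoluteAnabelian.AbsAnabFundamentalGroups
import HarnessLib

/-!
# Joshi, *Arithmetic Teichmüller spaces I* (v4) Def. 5.1.1 (6)(b) / Rmk. 5.1.2 / Prop. 5.8.1 (2) — the geometric
# compatibility of the label DISCHARGED from [AbsAnab] Lem. 1.3.8 (FACT-LIST F-0007 `PreservesGeom`) at named instances

Proof-only companion of the abc-iut cell, branch E (seat abc-iut-E-t1, [J-I] carrier owner; rung LADDER-ABC:A2.E) to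
`ArithTeichmullerSpacePointed.lean` (p431520: `ATSObjPointed.GeomCompatible`, `Rmk512`), `ArithTeichmullerSpace.lean` (p428170:
`ATSObj.geomSubgroup`) and E-t21's `ATS1SpacesStructure.lean` (p431517: `ATSObj.PreservesGeomSubgroup`,
`ATSObj.galoisEquivOfGeomSubgroupEq`). TAKES NO SIDE on [IUTchIII] Cor. 3.12 or on any author; typed ≠ proved ≠ endorsed.

PRINT. K. Joshi, arXiv 2106.11452 **v4**, Def. 5.1.1 p.22 l.22 – p.23 l.9, clause (6)(b): «any such anabelomorphism induces an
anabelomorphism of their geometric tempered fundamental subgroups `Π^temp_{Y/K} ≃ Π^temp_{X/ℂ_p}`»; Rmk. 5.1.2 p.23 l.10–13: «In the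
principal case of hyperbolic curves over p-adic fields which occurs in the Anabelian Geometry literature, the requirement (4)(b) is
implied by (4)(a) (by [Mochizuki, 2004, Lemma 1.3.8]). I do not know if this is still true in the general case considered here.»;
Prop. 5.8.1 (2) p.29 l.10–23: «any anabelomorphism `Π^temp_{Y/E′} ≃ Π^temp_{X/E}` provides an anabelomorphism `G_{E′} ≃ G_E`».
The CITED input, S. Mochizuki, *The absolute anabelian geometry of hyperbolic curves* (2004), Lem. 1.3.8 p.18 («`Δ ⊆ Π` is
group-theoretic»: an isomorphism `Π₁ ≅ Π₂` of arithmetic fundamental groups of hyperbolic curves over p-adic fields carries `Δ₁` onto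
`Δ₂`), IS in the tree as the parametrised FACT-LIST fact **F-0007** `FundamentalExtension.PreservesGeom` (abc-iut-L4-t1,
`Literature/AnabelianGeometry/AbsoluteAnabelian/AbsAnabFundamentalGroups.lean`; admissible AT NAMED INSTANCES ONLY — its universal
closure over the abstract interface is refuted, f-052). The typing of p431520 recorded Rmk. 5.1.2 as a claim-`Prop` with the note
«the cited lemma … is not in the tree» — this file CORRECTS that note by binding F-0007 exactly as the (R1b′) chain of layer L2
does (`EtaleTheta.ThetaSetting.map_deltaTemp_eq_of_preservesGeom`, abc-iut's Sec1AutPreservesDeltaTemp.lean): at fundamental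
extensions `(E_Y, e_Y)`, `(E_X, e_X)` MODELLING `Π_Y ↠ G_{E′}` and `Π_X ↠ G_E` (`e : Π_E ⥲ Π̂` an identification of profinite groups
carrying `Δ_E` onto `Δ̂`), the instance of Lem. 1.3.8 at the profinite completion `α̂ := e_Y ≫ α̂ ≫ e_X⁻¹` of the label
`α : Π^temp_Y ⥲ Π^temp_X` (`EtaleTheta.Thm16Sub.completionIso`, [EtTh] Thm. 1.6 machinery of abc-iut-L6-d5).

WHAT IS PROVED (standard axioms; no `def`, no new `Prop`; hypotheses = F-0007 instances BY NAME + the model identifications):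
* §1 `deltaHat_comap_toHat` — `Π^temp_X ∩ Δ_X = Δ^temp_X` on the [SemiAnbd] §6 interface `TemperedCurve` (from `augHat ∘ toHat =
  aug` and closedness of `Ker(augHat)`; the `ThetaSetting` form is abc-iut-L3's `comap_toHat_deltaHat`), and the TWO-CURVE
  equivalence `map_deltaTemp_eq_iff_map_deltaHat_eq`: `α(Δ^temp_Y) = Δ^temp_X ⟺ α̂(Δ_Y) = Δ_X` ([AbsAnab] Lem. 1.3.8 in tempered and
  in profinite form are interchangeable for a label between DIFFERENT curves; the one-curve / `ThetaSetting` forms are L6-d5's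
  `Thm16Sub.map_deltaHat_eq` / `hΔ_of_map_deltaHat_eq`).
* §2 `preservesGeom_iff_map_deltaHat_eq` — at models `(E_Y,e_Y)`, `(E_X,e_X)` the F-0007 instance `PreservesGeom (e_Y ≫ α̂ ≫ e_X⁻¹)`
  is EQUIVALENT to `α̂(Δ_Y) = Δ_X`, hence (`preservesGeom_iff_map_deltaTemp_eq`) to `α(Δ^temp_Y) = Δ^temp_X`: the instance of the
  fact consumed here is EXACTLY clause (6)(b) — nothing weaker, nothing stronger (tightness of the binding; no junk instance).
* §3 consequences on the [J-I] carriers: `ATSObj.geomSubgroup_eq_of_preservesGeom` (base-point-free objects, p428170),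
  `ATSObjPointed.geomCompatible_of_preservesGeom` / `geomCompatible_iff_preservesGeom` (pointed objects, p431520),
  **`rmk512_of_preservesGeom`** — Joshi's Rmk. 5.1.2 (`Rmk512 X 𝔅 F`) HOLDS given, for every pointed object, the F-0007 instance at
  its label (DISCHARGED modulo F-0007 at named instances, the cone's standing rule for this fact), and conversely
  `preservesGeom_of_rmk512`; **`ATSObj.preservesGeomSubgroup_of_preservesGeom`** — E-t21's claim-`Prop` for Prop. 5.8.1 (2)
  (`PreservesGeomSubgroup IsHyp X`) likewise; and the PRINTED CONCLUSION of Prop. 5.8.1 (2), `G_{E′} ≃ G_E`, for every object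
  carrying such an instance (`ATSObj.nonempty_galoisEquiv_of_preservesGeom`, via E-t21's `galoisEquivOfGeomSubgroupEq`).
Nothing of print is asserted; whether the F-0007 instances hold at the curves of interest is [AbsAnab] Lem. 1.3.8 itself (a
refereed, undisputed result — consumed BY NAME, not proved here).
-/

namespace Summit.ABC.IUTFork.Joshi

open Literature.AnabelianGeometry.SemiGraphs (TemperedCurve)
open Literature.AnabelianGeometry.AbsoluteAnabelian (FundamentalExtension)
open Literature.AnabelianGeometry.AbsoluteAnabelian.FundamentalExtension (PreservesGeom)
open Literature.AnabelianGeometry.EtaleTheta (Thm16Sub.completionIso Thm16Sub.completionIso_toHat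
  Thm16Sub.completionIso_toHat' Thm16Sub.map_deltaHat_eq Thm16Sub.map_comap_eq_comap_map)

variable {p : ℕ} [Fact p.Prime]

/-! ## 1. `Π^temp ∩ Δ̂ = Δ^temp`, and [AbsAnab] Lem. 1.3.8 tempered ⟺ profinite for a label between two curves -/

/-- **`Π^temp_X ∩ Δ_X = Δ^temp_X` inside `Π_X`** on the [SemiAnbd] §6 interface: the pull-back of `Δ_X` (closure of the image of
`Δ^temp_X`) along `Π^temp_X → Π_X` is `Δ^temp_X` — from `augHat ∘ toHat = aug` and closedness of `Ker(augHat)` in the Hausdorff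
`G_{ℚ_p}`. (The `ThetaSetting` form is abc-iut-L3's `EtaleTheta.ThetaSetting.comap_toHat_deltaHat`.) [cite: MochizukiSemiAnbd2006, §6 p.69] -/
theorem deltaHat_comap_toHat (X : TemperedCurve p) : X.DeltaHat.comap X.toHat.toMonoidHom = X.DeltaTemp := by
  apply le_antisymm
  · intro x hx
    have hker : IsClosed ((X.augHat.toMonoidHom.ker : Subgroup X.PiHat) : Set X.PiHat) := by
      have h1 : ((X.augHat.toMonoidHom.ker : Subgroup X.PiHat) : Set X.PiHat) = X.augHat ⁻¹' {1} := by
        ext y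
        simp [MonoidHom.mem_ker]
      rw [h1]
      exact isClosed_singleton.preimage (map_continuous X.augHat)
    have hle : X.DeltaTemp.map X.toHat.toMonoidHom ≤ X.augHat.toMonoidHom.ker := by
      rintro _ ⟨y, hy, rfl⟩
      have hy' : X.aug y = 1 := hy
      simp [MonoidHom.mem_ker, X.augHat_comp, hy']
    have hx' := (Subgroup.topologicalClosure_minimal _ hle hker) hx
    have : X.aug x = 1 := by simpa [MonoidHom.mem_ker, X.augHat_comp] using hx'
    exact this
  · intro x hx
    exact Subgroup.le_topologicalClosure _ ⟨x, hx, rfl⟩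

/-- **Profinite ⇒ tempered, two curves**: if the completion `α̂ : Π_Y ⥲ Π_X` of a label `α : Π^temp_Y ⥲ Π^temp_X` carries `Δ_Y` onto
`Δ_X`, then `α` carries `Δ^temp_Y` onto `Δ^temp_X` (because `Δ^temp = Π^temp ∩ Δ̂` on both sides and `α̂ ∘ toHat = toHat ∘ α`).
[cite: MochizukiEtTh2009, Thm 1.6 (i) p.24] -/
theorem map_deltaTemp_eq_of_map_deltaHat_eq (Y X : TemperedCurve p) (α : Y.PiTemp ≃ₜ* X.PiTemp)
    (h : Y.DeltaHat.map (Thm16Sub.completionIso Y X α).toMulEquiv.toMonoidHom = X.DeltaHat) :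
    Y.DeltaTemp.map α.toMulEquiv.toMonoidHom = X.DeltaTemp := by
  rw [← deltaHat_comap_toHat Y, ← deltaHat_comap_toHat X,
    Thm16Sub.map_comap_eq_comap_map α.toMulEquiv (Thm16Sub.completionIso Y X α).toMulEquiv Y.toHat.toMonoidHom
      X.toHat.toMonoidHom (Thm16Sub.completionIso_toHat' Y X α), h]

/-- **[AbsAnab] Lem. 1.3.8 in tempered and in profinite form are EQUIVALENT for a label between two curves**:
`α(Δ^temp_Y) = Δ^temp_X ⟺ α̂(Δ_Y) = Δ_X` (⇒ is abc-iut-L6-d5's `Thm16Sub.map_deltaHat_eq`). [cite: MochizukiEtTh2009, Thm 1.6 (i) p.24] -/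
theorem map_deltaTemp_eq_iff_map_deltaHat_eq (Y X : TemperedCurve p) (α : Y.PiTemp ≃ₜ* X.PiTemp) :
    Y.DeltaTemp.map α.toMulEquiv.toMonoidHom = X.DeltaTemp ↔
      Y.DeltaHat.map (Thm16Sub.completionIso Y X α).toMulEquiv.toMonoidHom = X.DeltaHat :=
  ⟨Thm16Sub.map_deltaHat_eq Y X α, map_deltaTemp_eq_of_map_deltaHat_eq Y X α⟩

/-! ## 2. The F-0007 instance at models `(E_Y, e_Y)`, `(E_X, e_X)` of `Π_Y ↠ G_{E′}`, `Π_X ↠ G_E` is EXACTLY clause (6)(b) -/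

section Instance

variable {Y X : TemperedCurve p} (α : Y.PiTemp ≃ₜ* X.PiTemp)
  (EY EX : FundamentalExtension.{0}) (eY : EY.arith ≃ₜ* Y.PiHat) (eX : EX.arith ≃ₜ* X.PiHat)

/-- Plumbing: transporting a subgroup along `e_Y ≫ α̂ ≫ e_X⁻¹` is transporting along the three maps in turn. [folklore] -/
theorem map_trans_trans_symm (S : Subgroup EY.arith) :
    S.map (eY.trans ((Thm16Sub.completionIso Y X α).trans eX.symm)).toMulEquiv.toMonoidHom =
      ((S.map eY.toMulEquiv.toMonoidHom).map (Thm16Sub.completionIso Y X α).toMulEquiv.toMonoidHom).map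
        eX.symm.toMulEquiv.toMonoidHom := by
  rw [Subgroup.map_map, Subgroup.map_map]
  rfl

variable (heY : EY.geom.map eY.toMulEquiv.toMonoidHom = Y.DeltaHat) (heX : EX.geom.map eX.toMulEquiv.toMonoidHom = X.DeltaHat)
include heY heX

/-- **The F-0007 instance is `α̂(Δ_Y) = Δ_X`.** At fundamental extensions `(E_Y, e_Y)`, `(E_X, e_X)` modelling `Π_Y ↠ G_{E′}` and
`Π_X ↠ G_E` (`e_Y(Δ_{E_Y}) = Δ_Y`, `e_X(Δ_{E_X}) = Δ_X`), [AbsAnab] Lem. 1.3.8 AT the isomorphism `e_Y ≫ α̂ ≫ e_X⁻¹ : Π_{E_Y} ⥲ Π_{E_X}`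
(FACT-LIST F-0007 `PreservesGeom`, by name) says precisely that `α̂` carries `Δ_Y` onto `Δ_X`. [cite: MochizukiAbsAnab2004, Lemma 1.3.8 p.18] -/
theorem preservesGeom_iff_map_deltaHat_eq :
    PreservesGeom (E := EY) (F := EX) (eY.trans ((Thm16Sub.completionIso Y X α).trans eX.symm)) ↔
      Y.DeltaHat.map (Thm16Sub.completionIso Y X α).toMulEquiv.toMonoidHom = X.DeltaHat := by
  have hX : EX.geom = X.DeltaHat.map eX.symm.toMulEquiv.toMonoidHom := by
    rw [← heX, Subgroup.map_map]
    convert (Subgroup.map_id EX.geom).symm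
    ext x
    exact eX.symm_apply_apply x
  have hinj : Function.Injective (Subgroup.map eX.symm.toMulEquiv.toMonoidHom : Subgroup X.PiHat → Subgroup EX.arith) :=
    Subgroup.map_injective eX.symm.injective
  unfold PreservesGeom
  rw [map_trans_trans_symm α EY EX eY eX, heY, hX]
  exact hinj.eq_iff

/-- **The F-0007 instance is clause (6)(b)**: at the models, `PreservesGeom (e_Y ≫ α̂ ≫ e_X⁻¹) ⟺ α(Δ^temp_Y) = Δ^temp_X`.
[cite: MochizukiAbsAnab2004, Lemma 1.3.8 p.18] -/
theorem preservesGeom_iff_map_deltaTemp_eq :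
    PreservesGeom (E := EY) (F := EX) (eY.trans ((Thm16Sub.completionIso Y X α).trans eX.symm)) ↔
      Y.DeltaTemp.map α.toMulEquiv.toMonoidHom = X.DeltaTemp := by
  rw [preservesGeom_iff_map_deltaHat_eq α EY EX eY eX heY heX, map_deltaTemp_eq_iff_map_deltaHat_eq]

/-- **hΔ for a label BY NAME from F-0007** (two-curve form of abc-iut-L2's `map_deltaTemp_eq_of_preservesGeom`): the instance of
[AbsAnab] Lem. 1.3.8 at `e_Y ≫ α̂ ≫ e_X⁻¹` gives `α(Δ^temp_Y) = Δ^temp_X`. [cite: MochizukiAbsAnab2004, Lemma 1.3.8 p.18] -/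
theorem map_deltaTemp_eq_of_preservesGeom
    (h138 : PreservesGeom (E := EY) (F := EX) (eY.trans ((Thm16Sub.completionIso Y X α).trans eX.symm))) :
    Y.DeltaTemp.map α.toMulEquiv.toMonoidHom = X.DeltaTemp :=
  (preservesGeom_iff_map_deltaTemp_eq α EY EX eY eX heY heX).1 h138

end Instance

/-! ## 3. Consequences on the [J-I] carriers: Def. 5.1.1 (6)(b), Rmk. 5.1.2, Prop. 5.8.1 (2) -/

namespace ATSObj

variable {X : TemperedCurve p}

/-- **Def. 5.1.1 (6)(b) for a base-point-free object from F-0007**: at models `(E_Y, e_Y)` of `Π_Y ↠ G_{E′}` and `(E_X, e_X)` of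
`Π_X ↠ G_E`, the instance of [AbsAnab] Lem. 1.3.8 at the completed label gives `α(Δ^temp_Y) = Δ^temp_X`, i.e. `geomSubgroup A = Δ^temp_X`.
[cite: MochizukiAbsAnab2004, Lemma 1.3.8 p.18] -/
theorem geomSubgroup_eq_of_preservesGeom (A : ATSObj X) (EY EX : FundamentalExtension.{0}) (eY : EY.arith ≃ₜ* A.Y.PiHat)
    (eX : EX.arith ≃ₜ* X.PiHat) (heY : EY.geom.map eY.toMulEquiv.toMonoidHom = A.Y.DeltaHat)
    (heX : EX.geom.map eX.toMulEquiv.toMonoidHom = X.DeltaHat)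
    (h138 : PreservesGeom (E := EY) (F := EX) (eY.trans ((Thm16Sub.completionIso A.Y X A.α).trans eX.symm))) :
    A.geomSubgroup = X.DeltaTemp :=
  map_deltaTemp_eq_of_preservesGeom A.α EY EX eY eX heY heX h138

/-- Conversely an object whose label carries `Δ^temp_Y` onto `Δ^temp_X` yields the F-0007 instance at any models — the binding is
tight. [cite: MochizukiAbsAnab2004, Lemma 1.3.8 p.18] -/
theorem preservesGeom_of_geomSubgroup_eq (A : ATSObj X) (EY EX : FundamentalExtension.{0}) (eY : EY.arith ≃ₜ* A.Y.PiHat)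
    (eX : EX.arith ≃ₜ* X.PiHat) (heY : EY.geom.map eY.toMulEquiv.toMonoidHom = A.Y.DeltaHat)
    (heX : EX.geom.map eX.toMulEquiv.toMonoidHom = X.DeltaHat) (h : A.geomSubgroup = X.DeltaTemp) :
    PreservesGeom (E := EY) (F := EX) (eY.trans ((Thm16Sub.completionIso A.Y X A.α).trans eX.symm)) :=
  (preservesGeom_iff_map_deltaTemp_eq A.α EY EX eY eX heY heX).2 h

/-- **The printed conclusion of Prop. 5.8.1 (2) from F-0007** (p.29 l.10–23 «… provides an anabelomorphism `G_{E′} ≃ G_E`»): an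
object carrying the instance of [AbsAnab] Lem. 1.3.8 at its completed label has base field anabelomorphic to `E` — via E-t21's
`galoisEquivOfGeomSubgroupEq` (`Π^temp/Δ^temp ≅ range(aug) = G_K`). [cite: MochizukiAbsAnab2004, Lemma 1.3.8 p.18] -/
theorem nonempty_galoisEquiv_of_preservesGeom (A : ATSObj X) (EY EX : FundamentalExtension.{0}) (eY : EY.arith ≃ₜ* A.Y.PiHat)
    (eX : EX.arith ≃ₜ* X.PiHat) (heY : EY.geom.map eY.toMulEquiv.toMonoidHom = A.Y.DeltaHat)
    (heX : EX.geom.map eX.toMulEquiv.toMonoidHom = X.DeltaHat)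
    (h138 : PreservesGeom (E := EY) (F := EX) (eY.trans ((Thm16Sub.completionIso A.Y X A.α).trans eX.symm))) :
    Nonempty (A.Y.GK ≃* X.GK) :=
  ⟨galoisEquivOfGeomSubgroupEq A (geomSubgroup_eq_of_preservesGeom A EY EX eY eX heY heX h138)⟩

/-- **E-t21's claim-`Prop` for Prop. 5.8.1 (2) DISCHARGED modulo F-0007**: if every object of `𝔍_hyp(X,E)` carries models of
`Π_Y ↠ G_{E′}`, `Π_X ↠ G_E` at which the instance of [AbsAnab] Lem. 1.3.8 for its completed label holds, then `PreservesGeomSubgroup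
IsHyp X` (ATS1SpacesStructure, p431517). [cite: MochizukiAbsAnab2004, Lemma 1.3.8 p.18] -/
theorem preservesGeomSubgroup_of_preservesGeom {IsHyp : TemperedCurve p → Prop}
    (h : ∀ A ∈ Jhyp IsHyp X, ∃ (EY EX : FundamentalExtension.{0}) (eY : EY.arith ≃ₜ* A.Y.PiHat) (eX : EX.arith ≃ₜ* X.PiHat),
      EY.geom.map eY.toMulEquiv.toMonoidHom = A.Y.DeltaHat ∧ EX.geom.map eX.toMulEquiv.toMonoidHom = X.DeltaHat ∧
        PreservesGeom (E := EY) (F := EX) (eY.trans ((Thm16Sub.completionIso A.Y X A.α).trans eX.symm))) :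
    PreservesGeomSubgroup IsHyp X := by
  intro _ A hA
  obtain ⟨EY, EX, eY, eX, heY, heX, h138⟩ := h A hA
  exact geomSubgroup_eq_of_preservesGeom A EY EX eY eX heY heX h138

end ATSObj

namespace ATSObjPointed

variable {X : TemperedCurve p} {𝔅 : ∀ Y : TemperedCurve p, ATS1.BerkovichDatum Y} {F : Type} [NormedField F]
  [CompleteSpace F] [IsUltrametricDist F] [IsAlgClosed F] [CharP F p]

/-- **Def. 5.1.1 (6)(b) for a POINTED object from F-0007**: the instance of [AbsAnab] Lem. 1.3.8 at the completed label (at models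
`(E_Y, e_Y)`, `(E_X, e_X)`) gives `GeomCompatible A`. [cite: MochizukiAbsAnab2004, Lemma 1.3.8 p.18] -/
theorem geomCompatible_of_preservesGeom (A : ATSObjPointed X 𝔅 F) (EY EX : FundamentalExtension.{0})
    (eY : EY.arith ≃ₜ* A.Y.PiHat) (eX : EX.arith ≃ₜ* X.PiHat) (heY : EY.geom.map eY.toMulEquiv.toMonoidHom = A.Y.DeltaHat)
    (heX : EX.geom.map eX.toMulEquiv.toMonoidHom = X.DeltaHat)
    (h138 : PreservesGeom (E := EY) (F := EX) (eY.trans ((Thm16Sub.completionIso A.Y X A.α).trans eX.symm))) :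
    A.GeomCompatible :=
  map_deltaTemp_eq_of_preservesGeom A.α EY EX eY eX heY heX h138

/-- **Clause (6)(b) ⟺ the F-0007 instance** at any models of `Π_Y ↠ G_{E′}`, `Π_X ↠ G_E`: what the typing named `GeomCompatible`
is exactly the instance of [AbsAnab] Lem. 1.3.8 that Rmk. 5.1.2 invokes. [cite: MochizukiAbsAnab2004, Lemma 1.3.8 p.18] -/
theorem geomCompatible_iff_preservesGeom (A : ATSObjPointed X 𝔅 F) (EY EX : FundamentalExtension.{0})
    (eY : EY.arith ≃ₜ* A.Y.PiHat) (eX : EX.arith ≃ₜ* X.PiHat) (heY : EY.geom.map eY.toMulEquiv.toMonoidHom = A.Y.DeltaHat)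
    (heX : EX.geom.map eX.toMulEquiv.toMonoidHom = X.DeltaHat) :
    A.GeomCompatible ↔ PreservesGeom (E := EY) (F := EX) (eY.trans ((Thm16Sub.completionIso A.Y X A.α).trans eX.symm)) :=
  (preservesGeom_iff_map_deltaTemp_eq A.α EY EX eY eX heY heX).symm

end ATSObjPointed

section Rmk512

variable {X : TemperedCurve p} {𝔅 : ∀ Y : TemperedCurve p, ATS1.BerkovichDatum Y} {F : Type} [NormedField F]
  [CompleteSpace F] [IsUltrametricDist F] [IsAlgClosed F] [CharP F p]

variable (X 𝔅 F) in
/-- **Joshi's Rmk. 5.1.2 DISCHARGED modulo F-0007 at named instances** (p.23 l.11–14 «the requirement (4)(b) is implied by (4)(a) (by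
[Mochizuki, 2004, Lemma 1.3.8])»): if every pointed object `A` of `𝔍(X,E)` carries models `(E_Y, e_Y)` of `Π_Y ↠ G_{E′}` and
`(E_X, e_X)` of `Π_X ↠ G_E` at which the instance of [AbsAnab] Lem. 1.3.8 for the completed label `e_Y ≫ α̂ ≫ e_X⁻¹` holds (FACT-LIST
F-0007 `PreservesGeom`, consumed BY NAME), then `Rmk512 X 𝔅 F`. The hypothesis is the cone's standing form of this fact («at named
instances only»); nothing of [AbsAnab] is proved here. [cite: MochizukiAbsAnab2004, Lemma 1.3.8 p.18] -/
theorem rmk512_of_preservesGeom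
    (h : ∀ A : ATSObjPointed X 𝔅 F, ∃ (EY EX : FundamentalExtension.{0}) (eY : EY.arith ≃ₜ* A.Y.PiHat)
      (eX : EX.arith ≃ₜ* X.PiHat), EY.geom.map eY.toMulEquiv.toMonoidHom = A.Y.DeltaHat ∧
        EX.geom.map eX.toMulEquiv.toMonoidHom = X.DeltaHat ∧
          PreservesGeom (E := EY) (F := EX) (eY.trans ((Thm16Sub.completionIso A.Y X A.α).trans eX.symm))) :
    ATSObjPointed.Rmk512 X 𝔅 F := by
  intro A
  obtain ⟨EY, EX, eY, eX, heY, heX, h138⟩ := h A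
  exact ATSObjPointed.geomCompatible_of_preservesGeom A EY EX eY eX heY heX h138

/-- Conversely `Rmk512` supplies the F-0007 instance at EVERY choice of models for every pointed object (tightness: the claim and
the fact-instances say the same thing on the interface). [cite: MochizukiAbsAnab2004, Lemma 1.3.8 p.18] -/
theorem preservesGeom_of_rmk512 (h : ATSObjPointed.Rmk512 X 𝔅 F) (A : ATSObjPointed X 𝔅 F) (EY EX : FundamentalExtension.{0})
    (eY : EY.arith ≃ₜ* A.Y.PiHat) (eX : EX.arith ≃ₜ* X.PiHat) (heY : EY.geom.map eY.toMulEquiv.toMonoidHom = A.Y.DeltaHat)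
    (heX : EX.geom.map eX.toMulEquiv.toMonoidHom = X.DeltaHat) :
    PreservesGeom (E := EY) (F := EX) (eY.trans ((Thm16Sub.completionIso A.Y X A.α).trans eX.symm)) :=
  (ATSObjPointed.geomCompatible_iff_preservesGeom A EY EX eY eX heY heX).1 (h A)

/-- **Prop. 5.8.1 (2) for every pointed object, from F-0007**: under the instances, `G_{E′} ≃ G_E` (E-t21's bridge
`nonempty_galoisEquiv_of_rmk512` p433841 took Joshi's Rmk. 5.1.2 as the hypothesis; here the hypothesis is the cited lemma's
instances). [cite: MochizukiAbsAnab2004, Lemma 1.3.8 p.18] -/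
theorem ATSObjPointed.nonempty_galoisEquiv_of_preservesGeom (A : ATSObjPointed X 𝔅 F) (EY EX : FundamentalExtension.{0})
    (eY : EY.arith ≃ₜ* A.Y.PiHat) (eX : EX.arith ≃ₜ* X.PiHat) (heY : EY.geom.map eY.toMulEquiv.toMonoidHom = A.Y.DeltaHat)
    (heX : EX.geom.map eX.toMulEquiv.toMonoidHom = X.DeltaHat)
    (h138 : PreservesGeom (E := EY) (F := EX) (eY.trans ((Thm16Sub.completionIso A.Y X A.α).trans eX.symm))) :
    Nonempty (A.Y.GK ≃* X.GK) :=
  ATSObj.nonempty_galoisEquiv_of_preservesGeom A.toATSObj EY EX eY eX heY heX h138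

end Rmk512

end Summit.ABC.IUTFork.Joshi
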